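import Literature.AnabelianGeometry.EtaleTheta.SettingModelChiInversionAut
import Literature.AnabelianGeometry.EtaleTheta.SettingModelChiThetaCusp
import Literature.AnabelianGeometry.EtaleTheta.SettingModelChiCensusClauses
import Literature.AnabelianGeometry.EtaleTheta.SettingModelTateInversionAut
import Literature.AnabelianGeometry.EtaleTheta.SettingModelTateThetaCusp
import HarnessLib

/-!
# `IsInversionAut` at the CUSPED χ-models (`modelχ′`, `modelχq′`), and the inversion fixes the cusp's decomposition group
# (proof-only NV; C11a at the sites WITH a cusp)

Mochizuki, *The étale theta function …*, Publ. RIMS **45** (2009) [EtTh], Prop. 1.5 (iii) p. 23 («any inversion automorphism ι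
of Π^tp_Y … which fixes the irreducible component … labeled 0»), Def. 2.5 (i) p. 39 [cite: MochizukiEtTh2009, Prop 1.5 (iii) p.23].
abc-iut cell, layer L2, prover abc-iut-L2-d1 (gen 5); PROOF-ONLY.  abc-iut-L2-t1's `ThetaSetting.IsInversionAut` was witnessed
by this seat at the cusp-LESS models (`modelχ` p442712, `modelχq` p446537, `Pt` empty there); here it is transferred field
by field to abc-iut-w5-d029 / abc-iut-L2-t8's CUSPED records `modelχ′ p` (`SettingModelChiThetaCusp`) and `modelχq′ p i j hj`
(`SettingModelTateThetaCusp`) — same `Π^tp_X`, `Y_N`, `Z_N`, `toZ`, theta quotients, plus ONE cusp `x` with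
`D_x = b^Ẑ ⋊ G_{ℚ_p}` — where the print-side normalisation «ι fixes the cusp / the component labelled 0» is STATABLE:
* `isInversionAut_twistedInversion_modelχ'`, `isInversionAut_inversionχq_modelχq'`;
* `ι(D_x) = D_x` for the cusp `x`: stage 1 is abc-iut's `map_decomp_twistedInversion_modelχ'` (`SettingModelChiCensusClauses`,
  imported); stage 2 **`map_decomp_inversionχq_modelχq'`** here (abc-iut-w5-d249's `inversionχq_mem_cuspDecompχq_iff`);
* NV `ThetaSetting.exists_isCusp_isInversionAut_map_decomp`: SOME Theta setting of [EtTh] origin HAS a cusp `x` and an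
  inversion automorphism `ι` with `ι(D_x) = D_x`.
(`FixesCuspBelow ι y` itself needs a `CuspidalPointDd` over a Kummer datum at the cusped model — abc-iut-L2-t10's R313 at
the Krull carrier; not claimed here.)  SEMI-SYNTHETIC MODELS, consistency evidence only; nothing of [EtTh] asserted; no side
taken on [IUTchIII] Cor. 3.12.
-/

noncomputable section

namespace Literature.AnabelianGeometry.EtaleTheta.SettingModel

open Literature.AnabelianGeometry.SemiGraphs _root_.Function

variable (p : ℕ) [Fact p.Prime]

/-! ### Stage 1: the cusped χ-model `modelχ′` -/

/-- **The twisted inversion IS an inversion automorphism of the CUSPED χ-model `modelχ′`** (same group data as `modelχ`;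
abc-iut-L2-t1's `IsInversionAut`, field by field from this seat's cusp-less witnesses). [cite: MochizukiEtTh2009, Prop 1.5 (iii) p.23] -/
theorem isInversionAut_twistedInversion_modelχ' :
    (ThetaSetting.modelχ' p).IsInversionAut (twistedInversionTop (chi p) (isInducing_leftRightχ p)) where
  aug_apply g := aug_twistedInversion_modelχ p g
  toZ_apply g := toZ_twistedInversion_modelχ p g
  ell_apply _ hg := thetaToEll_toTheta_twistedInversion p hg
  map_GtpYN N := map_YNχ_twistedInversion p N
  map_GtpZN N := map_ZNχ_twistedInversion p N

/-- **NV at a setting WITH a cusp**: SOME Theta setting of [EtTh] origin has a cusp `x` and an inversion automorphism `ι`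
(Prop. 1.5 (iii)) fixing the decomposition group of `x` (the cusped χ-model and its twisted inversion).
[cite: MochizukiEtTh2009, Prop 1.5 (iii) p.23] -/
theorem _root_.Literature.AnabelianGeometry.EtaleTheta.ThetaSetting.exists_isCusp_isInversionAut_map_decomp :
    ∃ (D : ThetaSetting p) (x : D.Pt) (ι : D.PiTemp ≃ₜ* D.PiTemp), D.IsEtThOrigin ∧ D.IsCusp x ∧ D.IsInversionAut ι ∧
      (D.decomp x).map ι.toMulEquiv.toMonoidHom = D.decomp x := by
  obtain ⟨x, hx⟩ := exists_isCusp_modelχ' p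
  exact ⟨ThetaSetting.modelχ' p, x, twistedInversionTop (chi p) (isInducing_leftRightχ p), ThetaSetting.modelχ'_isEtThOrigin p,
    hx, isInversionAut_twistedInversion_modelχ' p, map_decomp_twistedInversion_modelχ' p x⟩

/-! ### Stage 2: the cusped Tate-sheared model `modelχq′` -/

variable (i j : ℤ) (hj : Even j)

/-- **The cocycle-corrected inversion IS an inversion automorphism of the CUSPED stage-2 model `modelχq′`** (even `j`; field by
field from `isInversionAut_inversionχq`). [cite: MochizukiEtTh2009, Prop 1.5 (iii) p.23] -/
theorem isInversionAut_inversionχq_modelχq' :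
    (ThetaSetting.modelχq' p i j hj).IsInversionAut (inversionχq p i j) where
  aug_apply g := augχq_inversionχq p i j g
  toZ_apply g := gfpSnd_left_inversionχq p i j g
  ell_apply _ hg := thetaToEll_toTheta_inversionχq p i j hg
  map_GtpYN N := map_YNχq_inversionχq p i j hj N
  map_GtpZN N := map_ZNχq_inversionχq p i j N

/-- **`ι(D_x) = D_x` at the cusped stage-2 model** (abc-iut-w5-d249's `inversionχq_mem_cuspDecompχq_iff`: the defect
`b^{κ_p^{j−2i}}` lies on the `b`-axis). [cite: MochizukiEtTh2009, Prop 1.5 (iii) p.23] -/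
theorem map_decomp_inversionχq_modelχq' (x : (ThetaSetting.modelχq' p i j hj).Pt) :
    ((ThetaSetting.modelχq' p i j hj).decomp x).map (inversionχq p i j).toMulEquiv.toMonoidHom =
      (ThetaSetting.modelχq' p i j hj).decomp x := by
  ext g
  change g ∈ (cuspDecompχq p i j).map _ ↔ g ∈ cuspDecompχq p i j
  constructor
  · rintro ⟨h, hh, rfl⟩
    exact (inversionχq_mem_cuspDecompχq_iff p i j h).mpr hh
  · intro hg
    exact ⟨inversionχq p i j g, (inversionχq_mem_cuspDecompχq_iff p i j g).mpr hg, inversionχq_inversionχq p i j g⟩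

end Literature.AnabelianGeometry.EtaleTheta.SettingModel

end
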